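import Mathlib

/-!
# (N5) THE LOG-POTENTIAL ALONG AN AXIALLY PARAMETRISED SELECTION (nsreg-p2 g36 ROUND-46 v1.1 §7, plate t49-N5; text
`r46/Sketch46b.lean` sha16 642a48bf5342366b, Prop `NsregP2.R46b.AxialLogPotential`; seeds R47-1)

Width piece for crux `EulerZoomLiouville.PowerGaugeEulerLiouville` (stmt-NavierStokesRegularity-19832), by name under LEAD 19832
(ns-typeII-p2); seat ns-sfl-p1 g7, `--supports stmt-NavierStokesRegularity-19832 --as helper`.  Text binder-for-binder (`E3`
spelled out).

If `⟪y s, e⟫ = s` for all `s` (first hits parametrised by height), then for EVERY point `x` and `0 < δ₀ ≤ d`: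
`∫_{[a,b]} 1[δ₀ ≤ ‖x − y s‖ < d] / ‖x − y s‖ ds ≤ 2 (1 + log (d/δ₀))`.
Proof: `|⟪x,e⟫ − s| = |⟪x − y s, e⟫| ≤ ‖x − y s‖`, so the integrand is dominated by the explicit majorant
`𝟙_{|c−s|<δ₀}/δ₀ + 𝟙_{δ₀ ≤ c−s ≤ d}/(c−s) + 𝟙_{δ₀ ≤ s−c ≤ d}/(s−c)` (`c = ⟪x,e⟫`), whose integral over `ℝ` is
`2 + 2 log(d/δ₀)` (`integral_one_div`); `MeasureTheory.integral_mono_of_nonneg` needs no measurability of the integrand, so the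
hypothesis `Measurable y` is not used.  No continuity of `s ↦ y s` is needed either.

HONEST FRAMING: one-variable real analysis; nothing here proves the crux E (19832 OPEN), any door Target, or any Navier–Stokes
statement. [folklore (layer cake)]
-/

noncomputable section

open Set MeasureTheory Real
open scoped RealInnerProductSpace

set_option linter.dupNamespace false

namespace Summit.NavierStokesRegularity.NavierStokesRegularity.Theorems.PowerGaugeEulerLiouville.Condenser

/-- `∫_{[α−d, α−δ₀]} ds/(α − s) = log(d/δ₀)` for `0 < δ₀ ≤ d`. [folklore] -/
theorem integral_Icc_one_div_sub_left {α δ₀ d : ℝ} (hδ₀ : 0 < δ₀) (hδd : δ₀ ≤ d) :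
    ∫ s in Icc (α - d) (α - δ₀), 1 / (α - s) = Real.log (d / δ₀) := by
  rw [integral_Icc_eq_integral_Ioc, ← intervalIntegral.integral_of_le (by linarith),
    intervalIntegral.integral_comp_sub_left (fun u => 1 / u) α, sub_sub_cancel, sub_sub_cancel]
  exact integral_one_div (Set.notMem_uIcc_of_lt hδ₀ (hδ₀.trans_le hδd))

/-- `∫_{[α+δ₀, α+d]} ds/(s − α) = log(d/δ₀)` for `0 < δ₀ ≤ d`. [folklore] -/
theorem integral_Icc_one_div_sub_right {α δ₀ d : ℝ} (hδ₀ : 0 < δ₀) (hδd : δ₀ ≤ d) :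
    ∫ s in Icc (α + δ₀) (α + d), 1 / (s - α) = Real.log (d / δ₀) := by
  rw [integral_Icc_eq_integral_Ioc, ← intervalIntegral.integral_of_le (by linarith),
    intervalIntegral.integral_comp_sub_right (fun u => 1 / u) α, add_sub_cancel_left, add_sub_cancel_left]
  exact integral_one_div (Set.notMem_uIcc_of_lt hδ₀ (hδ₀.trans_le hδd))

/-- **(N5) `NsregP2.R46b.AxialLogPotential`, binder-for-binder.**  See the module docstring. [folklore (layer cake)] -/
theorem axialLogPotential :
    ∀ (e : EuclideanSpace ℝ (Fin 3)) (y : ℝ → EuclideanSpace ℝ (Fin 3)) (x : EuclideanSpace ℝ (Fin 3)) (a b δ₀ d : ℝ),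
      ‖e‖ = 1 → Measurable y → (∀ s, ⟪y s, e⟫ = s) → 0 < δ₀ → δ₀ ≤ d →
        ∫ s in Set.Icc a b, (if δ₀ ≤ ‖x - y s‖ ∧ ‖x - y s‖ < d then 1 / ‖x - y s‖ else 0)
          ≤ 2 * (1 + log (d / δ₀)) := by
  intro e y x a b δ₀ d he _ hye hδ₀ hδd
  set c : ℝ := ⟪x, e⟫ with hc
  have hcs : ∀ s, |c - s| ≤ ‖x - y s‖ := by
    intro s
    have h1 : ⟪x - y s, e⟫ = c - s := by rw [inner_sub_left, hye]
    rw [← h1]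
    calc |⟪x - y s, e⟫| ≤ ‖x - y s‖ * ‖e‖ := abs_real_inner_le_norm _ _
      _ = ‖x - y s‖ := by rw [he, mul_one]
  -- the explicit majorant
  set h₁ : ℝ → ℝ := (Ioo (c - δ₀) (c + δ₀)).indicator fun _ => 1 / δ₀ with hh₁
  set h₂ : ℝ → ℝ := (Icc (c - d) (c - δ₀)).indicator fun s => 1 / (c - s) with hh₂
  set h₃ : ℝ → ℝ := (Icc (c + δ₀) (c + d)).indicator fun s => 1 / (s - c) with hh₃
  have h1nn : ∀ s, 0 ≤ h₁ s := fun s => Set.indicator_nonneg (fun _ _ => by positivity) _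
  have h2nn : ∀ s, 0 ≤ h₂ s := fun s =>
    Set.indicator_nonneg (fun t (ht : t ∈ Icc (c - d) (c - δ₀)) => by
      have : 0 < c - t := by linarith [ht.2]
      positivity) _
  have h3nn : ∀ s, 0 ≤ h₃ s := fun s =>
    Set.indicator_nonneg (fun t (ht : t ∈ Icc (c + δ₀) (c + d)) => by
      have : 0 < t - c := by linarith [ht.1]
      positivity) _
  have hdom : ∀ s, (if δ₀ ≤ ‖x - y s‖ ∧ ‖x - y s‖ < d then 1 / ‖x - y s‖ else 0) ≤ h₁ s + h₂ s + h₃ s := by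
    intro s
    split_ifs with hcond
    · obtain ⟨hlo, hhi⟩ := hcond
      have ht := hcs s
      by_cases hlt : |c - s| < δ₀
      · have hmem : s ∈ Ioo (c - δ₀) (c + δ₀) := by
          rw [abs_lt] at hlt
          exact ⟨by linarith [hlt.2], by linarith [hlt.1]⟩
        have hv : h₁ s = 1 / δ₀ := by rw [hh₁, indicator_of_mem hmem]
        have hle : 1 / ‖x - y s‖ ≤ 1 / δ₀ := one_div_le_one_div_of_le hδ₀ hlo
        linarith [h2nn s, h3nn s]
      · push Not at hlt
        have hts : 1 / ‖x - y s‖ ≤ 1 / |c - s| := one_div_le_one_div_of_le (hδ₀.trans_le hlt) ht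
        rcases le_or_gt s c with hsc | hsc
        · have habs : |c - s| = c - s := abs_of_nonneg (by linarith)
          rw [habs] at hlt hts ht
          have hmem : s ∈ Icc (c - d) (c - δ₀) := ⟨by linarith, by linarith⟩
          have hv : h₂ s = 1 / (c - s) := by rw [hh₂, indicator_of_mem hmem]
          linarith [h1nn s, h3nn s]
        · have habs : |c - s| = s - c := by rw [abs_sub_comm]; exact abs_of_pos (by linarith)
          rw [habs] at hlt hts ht
          have hmem : s ∈ Icc (c + δ₀) (c + d) := ⟨by linarith, by linarith⟩
          have hv : h₃ s = 1 / (s - c) := by rw [hh₃, indicator_of_mem hmem]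
          linarith [h1nn s, h2nn s]
    · linarith [h1nn s, h2nn s, h3nn s]
  -- integrability of the majorant
  have hi₁ : Integrable h₁ := by
    rw [hh₁, integrable_indicator_iff measurableSet_Ioo]
    exact integrableOn_const measure_Ioo_lt_top.ne
  have hi₂ : Integrable h₂ := by
    rw [hh₂, integrable_indicator_iff measurableSet_Icc]
    refine ContinuousOn.integrableOn_Icc (continuousOn_const.div (continuousOn_const.sub continuousOn_id) ?_)
    intro s hs
    have : 0 < c - s := by linarith [hs.2]
    exact this.ne'
  have hi₃ : Integrable h₃ := by
    rw [hh₃, integrable_indicator_iff measurableSet_Icc]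
    refine ContinuousOn.integrableOn_Icc (continuousOn_const.div (continuousOn_id.sub continuousOn_const) ?_)
    intro s hs
    have : 0 < s - c := by linarith [hs.1]
    exact this.ne'
  have hi : Integrable fun s => h₁ s + h₂ s + h₃ s := (hi₁.add hi₂).add hi₃
  -- integrals of the majorant
  have hI₁ : ∫ s, h₁ s = 2 := by
    rw [hh₁, integral_indicator_const _ measurableSet_Ioo, Real.volume_real_Ioo_of_le (by linarith), smul_eq_mul]
    field_simp
    ring
  have hI₂ : ∫ s, h₂ s = Real.log (d / δ₀) := by
    rw [hh₂, integral_indicator measurableSet_Icc]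
    exact integral_Icc_one_div_sub_left hδ₀ hδd
  have hI₃ : ∫ s, h₃ s = Real.log (d / δ₀) := by
    rw [hh₃, integral_indicator measurableSet_Icc]
    exact integral_Icc_one_div_sub_right hδ₀ hδd
  -- assemble
  have hnn : ∀ s, 0 ≤ h₁ s + h₂ s + h₃ s := fun s => by linarith [h1nn s, h2nn s, h3nn s]
  have hfnn : ∀ s, (0 : ℝ) ≤ (if δ₀ ≤ ‖x - y s‖ ∧ ‖x - y s‖ < d then 1 / ‖x - y s‖ else 0) := by
    intro s
    split_ifs
    · positivity
    · exact le_rfl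
  have hi12 : Integrable (fun s => h₁ s + h₂ s) := hi₁.add hi₂
  have hsum : ∫ s, (h₁ s + h₂ s + h₃ s) = 2 * (1 + Real.log (d / δ₀)) := by
    have e1 : ∫ s, (h₁ s + h₂ s + h₃ s) = (∫ s, (h₁ s + h₂ s)) + ∫ s, h₃ s := integral_add hi12 hi₃
    have e2 : ∫ s, (h₁ s + h₂ s) = (∫ s, h₁ s) + ∫ s, h₂ s := integral_add hi₁ hi₂
    rw [e1, e2, hI₁, hI₂, hI₃]; ring
  calc ∫ s in Set.Icc a b, (if δ₀ ≤ ‖x - y s‖ ∧ ‖x - y s‖ < d then 1 / ‖x - y s‖ else 0)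
      ≤ ∫ s in Set.Icc a b, (h₁ s + h₂ s + h₃ s) :=
        integral_mono_of_nonneg (ae_of_all _ fun s => hfnn s) hi.integrableOn (ae_of_all _ hdom)
    _ ≤ ∫ s, (h₁ s + h₂ s + h₃ s) := setIntegral_le_integral hi (ae_of_all _ hnn)
    _ = 2 * (1 + Real.log (d / δ₀)) := hsum

end Summit.NavierStokesRegularity.NavierStokesRegularity.Theorems.PowerGaugeEulerLiouville.Condenser

end
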